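import Literature.Analysis.FluidPDE.AlexakisDoeringProofs
import Literature.Analysis.FluidPDE.DoeringFoiasPowerProofs
import HarnessLib

/-!
# Doering–Foias a-priori bounds: proof of the amplitude bound `F ≤ a U²/ℓ + b ν U/ℓ²`

Third sibling proof file of `Literature.Analysis.FluidPDE.DoeringFoias` (after
`DoeringFoiasProofs` — the power balance `ε ≤ ⟨f·u⟩` — and `DoeringFoiasPowerProofs` — the power
bound `⟨f·u⟩ ≤ F U`). It discharges the named fact
`Literature.Analysis.FluidPDE.DoeringFoias2002_amplitude_le` (Cheskidov–Doering–Petrov 2007, §III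
eqs. (18)–(19); Doering–Foias 2002, §3): for every forcing shape `Φ` on `T³` there are `a, b > 0`
(depending on `Φ` only) such that for every viscosity `ν > 0`, scale `ℓ = 1/n`, amplitude `F` and
every global Leray–Hopf solution `u` of the Navier–Stokes equations forced by `f(x) = F Φ(x/ℓ)`,
`|F| ≤ a U²/ℓ + b ν U/ℓ²` with `U = ⟨‖u‖₂²⟩^{1/2}` (`limsup` long-time average)
(`DoeringFoias2002_amplitude_le_holds`).

## The printed proof and its Lean rendering

Cheskidov–Doering–Petrov, §III (18)–(19): "Multiply the Navier–Stokes equation by a sufficiently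
smooth time-independent, divergence-free function `ψ(ℓ⁻¹x)` … satisfying `⟨Φ·ψ⟩ > 0` …
Integrating by parts, taking time averages, and applying Hölder and Cauchy–Schwarz,
`F⟨Φ·ψ⟩ = -⟨u·(∇ψ)·u⟩ - ν⟨u·Δψ⟩ ≤ ‖∇ψ‖_∞ avg‖u‖² + ν‖Δψ‖ (avg‖u‖²)^{1/2}`", hence (19)
`F ≤ ⟨Φ·ψ⟩⁻¹[‖∇̃ψ‖_∞ U²/ℓ + ‖ψ‖_{H²} νU/ℓ²]`. Here `Φ` is smooth, so `ψ = Φ` (`⟨Φ·Φ⟩ = 1`), i.e.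
the multiplier is `Ψ = Φ(n • ·)`. The whole multiplier argument for Leray–Hopf solutions in any
dimension is already in the tree as
`Literature.Analysis.FluidPDE.abs_amplitude_le_of_isGlobalLerayHopf` (`AlexakisDoeringProofs`,
written for the 2-D Alexakis–Doering twin `AlexakisDoering2006_amplitude_le`): the time-sliced weak
formulation tested with `Ψ` (`amplitude_mul_eq_of_isGlobalLerayHopf`), the pointwise-in-time
bound `|F| t ≤ ‖Ψ‖_∞‖u(t)‖₂ + |⟨u₀,Ψ⟩| + C∫₀ᵗ‖u‖₂² + νK_L∫₀ᵗ‖u‖₂`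
(`abs_amplitude_mul_le_of_isGlobalLerayHopf`), the energy growth `‖u(t)‖₂² = O(t)` which kills
the boundary term after division by `t`, and the passage to the `limsup`. That theorem, however,
assumes `U > 0` — used only to know that the Cesàro means `T⁻¹∫₀ᵀ‖u‖₂²` are *bounded*, i.e. that
the real-valued `limsup` is not the junk value `0` (`isBoundedUnder_timeMean_of_rmsVelocity_pos`).
The vendored 3-D statement has no such hypothesis (for `U = 0` it asserts `F = 0`), and indeed
none is needed: the Cesàro means of the energy of a global Leray–Hopf solution driven by a steady
smooth mean-zero force are bounded unconditionally — the standard a-priori energy estimate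
(energy inequality, Poincaré on the fluctuation, conservation of the mean flow), proved as
`Torus.IsGlobalLerayHopf.timeMean_norm_sq_le` in `DoeringFoiasPowerProofs` (cf.
Cheskidov–Doering–Petrov, §IV: "`‖u(·,t)‖²` is uniformly bounded in time for these … forces").

* `DoeringFoias.abs_amplitude_le_of_isGlobalLerayHopf` — the multiplier bound
  `|F| ≤ C U² + ν K_L U` for every global Leray–Hopf solution on `T^d` driven by `F Φ(n • ·)`,
  `ν > 0`, **without** the hypothesis `U > 0` (the proof of the `AlexakisDoeringProofs` theorem
  with the boundedness of the running means supplied by `timeMean_norm_sq_le`);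
* `DoeringFoias2002_amplitude_le_holds` — the discharge on `T³`, with `a = ‖∑ᵢ‖∂ᵢΦ‖‖_∞ + 1`,
  `b = ‖ΔΦ‖_∞ + 1` and the dilation bounds `∑ᵢ‖∂ᵢ(Φ(n • ·))‖ ≤ n‖∑ᵢ‖∂ᵢΦ‖‖_∞`,
  `‖Δ(Φ(n • ·))‖ ≤ n²‖ΔΦ‖_∞` (`exists_sum_norm_partialDeriv_comp_nsmul_le`,
  `exists_norm_laplacian_force_le`) giving the factors `ℓ⁻¹`, `ℓ⁻²` of eq. (19).

The statement is proved exactly as vendored (in particular for `|F|`, covering `F < 0`, and for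
arbitrary data `u₀`).

## References

* A. Cheskidov, C. R. Doering, N. P. Petrov, *Energy dissipation in fractal-forced flow*,
  J. Math. Phys. 48 (2007) 065208, arXiv:physics/0607280, §II p. 6 (`lim sup` remark), §III
  eqs. (18)–(19), §IV (uniform bound on `‖u(t)‖₂`, time averages of time derivatives).
* C. R. Doering, C. Foias, *Energy dissipation in body-forced turbulence*, J. Fluid Mech. 467
  (2002), 289–306, §3.
* A. Alexakis, C. R. Doering, Phys. Lett. A 359 (2006), 652–657, §2 (the 2-D twin, whose Lean
  proof is reused).
-/

noncomputable section

open MeasureTheory Set Function Filter Topology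
open scoped RealInnerProductSpace ENNReal NNReal

namespace Literature.Analysis.FluidPDE

open Literature.Analysis.FunctionSpaces

/-! ### The multiplier bound without the hypothesis `U > 0` -/

namespace DoeringFoias

variable {d : Type*} [Fintype d] [DecidableEq d]

variable {ν : ℝ} {Φ : ForcingShape d} {n : ℕ} {F : ℝ}
  {u : ℝ → UnitAddTorus d → EuclideanSpace ℝ d} {u₀ : UnitAddTorus d → EuclideanSpace ℝ d}

/-- **The Doering–Foias multiplier bound for Leray–Hopf solutions, unconditionally in `U`.** For a
global Leray–Hopf solution on `T^d` (any `d`) driven by `F Φ(n • ·)` with `ν > 0`, `0 < n`, and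
bounds `∑ᵢ‖∂ᵢΨ‖ ≤ C`, `‖ΔΨ‖ ≤ K_L` for the multiplier `Ψ = Φ(n • ·) = Φ.force n 1`, one has
`|F| ≤ C U² + ν K_L U` with `U = ⟨‖u‖₂²⟩^{1/2} ≥ 0` (Cheskidov–Doering–Petrov 2007, eq. (18):
`F⟨Φ·ψ⟩ ≤ ‖∇ψ‖_∞ avg‖u‖² + ν‖Δψ‖(avg‖u‖²)^{1/2}` with `ψ = Φ`). This is
`Literature.Analysis.FluidPDE.abs_amplitude_le_of_isGlobalLerayHopf` with its hypothesis `U > 0`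
removed: the running means `T⁻¹∫₀ᵀ‖u‖₂²` are bounded by the a-priori energy estimate
`Torus.IsGlobalLerayHopf.timeMean_norm_sq_le` (the force `F Φ(n • ·)` is steady, smooth and mean
zero), so `U² = limsup` is honest; the rest of the argument — division of the pointwise bound
`abs_amplitude_mul_le_of_isGlobalLerayHopf` by `t`, `‖u(t)‖₂ = O(√t)` for the boundary term
(`integral_norm_sq_le_of_isGlobalLerayHopf`), and `t → ∞` along times with
`T⁻¹∫₀ᵀ‖u‖₂² ≤ U² + δ` — is unchanged. [cite: CheskidovDoeringPetrov2006, §III eq. (18)] -/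
theorem abs_amplitude_le_of_isGlobalLerayHopf (hν : 0 < ν) (hn : 0 < n)
    (hu : Torus.IsGlobalLerayHopf ν (fun _ => Φ.force n F) u₀ u) {C KL : ℝ} (hC : 0 ≤ C)
    (hKL : 0 ≤ KL) (hCΨ : ∀ x, ∑ i, ‖Torus.partialDeriv i (Φ.force n 1) x‖ ≤ C)
    (hL : ∀ x, ‖Torus.laplacian (Φ.force n 1) x‖ ≤ KL) :
    |F| ≤ C * rmsVelocity longTimeAvgSup u ^ 2 + ν * KL * rmsVelocity longTimeAvgSup u := by
  obtain ⟨hΨ, -, -⟩ := ForcingShape.force_regular_holds Φ hn (1 : ℝ)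
  obtain ⟨KP, hKP, hP⟩ := Torus.exists_nonneg_forall_norm_le_of_continuous hΨ.continuous
  have hU0 : 0 ≤ rmsVelocity longTimeAvgSup u := Real.sqrt_nonneg _
  have hE0 : ∀ s, 0 ≤ ∫ x, ‖u s x‖ ^ 2 := fun s => integral_nonneg fun x => sq_nonneg _
  -- bounded running means of the energy (a-priori energy estimate) and their `limsup`
  have heb : IsBoundedUnder (· ≤ ·) atTop (timeMean fun s => ∫ x, ‖u s x‖ ^ 2) :=
    isBoundedUnder_of_eventually_le (eventually_atTop.2 ⟨1, fun t ht =>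
      hu.timeMean_norm_sq_le hν (Φ.isSmooth_force hn F) (Φ.hasZeroMean_force hn F) ht⟩)
  have heU : limsup (timeMean fun s => ∫ x, ‖u s x‖ ^ 2) atTop = rmsVelocity longTimeAvgSup u ^ 2 := by
    rw [rmsVelocity, Real.sq_sqrt (meanEnergy_nonneg u)]
    rfl
  obtain ⟨B, hB⟩ := heb
  rw [Filter.eventually_map] at hB
  -- Cauchy–Schwarz for the running means of `√E`
  have hIS : ∀ t, 0 < t → (∫ s in Ioc 0 t, Real.sqrt (∫ x, ‖u s x‖ ^ 2)) ≤
      t * Real.sqrt (timeMean (fun s => ∫ x, ‖u s x‖ ^ 2) t) := by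
    intro t ht
    have hJ := timeMean_sqrt_le_sqrt_timeMean ht hE0 (hu.integrableOn_integral_norm_sq ht)
    rw [timeMean, intervalIntegral.integral_of_le ht.le] at hJ
    have h2 := mul_le_mul_of_nonneg_left hJ ht.le
    rwa [← mul_assoc, mul_inv_cancel₀ ht.ne', one_mul] at h2
  have hIE : ∀ t, 0 < t → (∫ s in Ioc 0 t, ∫ x, ‖u s x‖ ^ 2) =
      t * timeMean (fun s => ∫ x, ‖u s x‖ ^ 2) t := by
    intro t ht
    rw [timeMean, intervalIntegral.integral_of_le ht.le, ← mul_assoc, mul_inv_cancel₀ ht.ne',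
      one_mul]
  -- running-mean form of the pointwise bound, for `t > 0`
  have hstep : ∀ t, 0 < t → |F| ≤ KP * Real.sqrt (∫ x, ‖u t x‖ ^ 2) / t +
      |∫ x, ⟪u₀ x, Φ.force n 1 x⟫| / t + C * timeMean (fun s => ∫ x, ‖u s x‖ ^ 2) t +
        |ν| * KL * Real.sqrt (timeMean (fun s => ∫ x, ‖u s x‖ ^ 2) t) := by
    intro t ht
    have h := abs_amplitude_mul_le_of_isGlobalLerayHopf hn hu hKP hKL hP hCΨ hL ht
    rw [hIE t ht] at h
    have h3 := mul_le_mul_of_nonneg_left (hIS t ht) (mul_nonneg (abs_nonneg ν) hKL)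
    have h' : |F| * t ≤ KP * Real.sqrt (∫ x, ‖u t x‖ ^ 2) + |∫ x, ⟪u₀ x, Φ.force n 1 x⟫| +
        C * (t * timeMean (fun s => ∫ x, ‖u s x‖ ^ 2) t) +
          |ν| * KL * (t * Real.sqrt (timeMean (fun s => ∫ x, ‖u s x‖ ^ 2) t)) := by
      linarith
    rw [← le_div_iff₀ ht] at h'
    refine h'.trans_eq ?_
    field_simp
  -- the energy grows at most linearly: `E t ≤ E₀ + (2|F| KP √B₊) t` eventually
  have hgrowth : ∀ᶠ t in atTop, ∫ x, ‖u t x‖ ^ 2 ≤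
      (∫ x, ‖u₀ x‖ ^ 2) + (2 * |F| * KP * Real.sqrt (max B 0)) * t := by
    filter_upwards [hB, eventually_gt_atTop (0 : ℝ)] with t hBt ht
    have h := integral_norm_sq_le_of_isGlobalLerayHopf hν.le hu hKP hP ht
    have h2 : Real.sqrt (timeMean (fun s => ∫ x, ‖u s x‖ ^ 2) t) ≤ Real.sqrt (max B 0) :=
      Real.sqrt_le_sqrt (hBt.trans (le_max_left _ _))
    have h3 : (∫ s in Ioc 0 t, Real.sqrt (∫ x, ‖u s x‖ ^ 2)) ≤ t * Real.sqrt (max B 0) :=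
      (hIS t ht).trans (mul_le_mul_of_nonneg_left h2 ht.le)
    have h4 := mul_le_mul_of_nonneg_left h3 (by positivity : 0 ≤ 2 * |F| * KP)
    linarith
  have hvanish : Tendsto (fun t => KP * Real.sqrt ((∫ x, ‖u₀ x‖ ^ 2) +
      (2 * |F| * KP * Real.sqrt (max B 0)) * t) / t + |∫ x, ⟪u₀ x, Φ.force n 1 x⟫| / t)
      atTop (𝓝 0) := by
    have h1 := (tendsto_sqrt_add_mul_div_atTop (∫ x, ‖u₀ x‖ ^ 2)
      (2 * |F| * KP * Real.sqrt (max B 0))).const_mul KP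
    have h2 := (tendsto_inv_atTop_zero : Tendsto (fun r : ℝ => r⁻¹) atTop (𝓝 0)).const_mul
      |∫ x, ⟪u₀ x, Φ.force n 1 x⟫|
    rw [mul_zero] at h1 h2
    have h := h1.add h2
    rw [add_zero] at h
    refine h.congr' ?_
    filter_upwards [eventually_gt_atTop (0 : ℝ)] with t ht
    simp only [div_eq_mul_inv]
    ring
  -- the `δ`-argument on the constant `|F|`
  have key : ∀ δ, 0 < δ → |F| ≤ δ + C * (rmsVelocity longTimeAvgSup u ^ 2 + δ) +
      |ν| * KL * Real.sqrt (rmsVelocity longTimeAvgSup u ^ 2 + δ) := by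
    intro δ hδ
    have heδ : ∀ᶠ t in atTop, timeMean (fun s => ∫ x, ‖u s x‖ ^ 2) t <
        rmsVelocity longTimeAvgSup u ^ 2 + δ :=
      eventually_lt_of_limsup_lt (by rw [heU]; linarith) ⟨B, Filter.eventually_map.mpr hB⟩
    have hvδ := hvanish.eventually (gt_mem_nhds hδ)
    obtain ⟨t, ht0, hgt, het, hvt⟩ :=
      ((eventually_gt_atTop (0 : ℝ)).and (hgrowth.and (heδ.and hvδ))).exists
    have h1 : KP * Real.sqrt (∫ x, ‖u t x‖ ^ 2) / t ≤
        KP * Real.sqrt ((∫ x, ‖u₀ x‖ ^ 2) + (2 * |F| * KP * Real.sqrt (max B 0)) * t) / t :=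
      div_le_div_of_nonneg_right (mul_le_mul_of_nonneg_left (Real.sqrt_le_sqrt hgt) hKP) ht0.le
    have h2 : C * timeMean (fun s => ∫ x, ‖u s x‖ ^ 2) t ≤
        C * (rmsVelocity longTimeAvgSup u ^ 2 + δ) := mul_le_mul_of_nonneg_left het.le hC
    have h3 : |ν| * KL * Real.sqrt (timeMean (fun s => ∫ x, ‖u s x‖ ^ 2) t) ≤
        |ν| * KL * Real.sqrt (rmsVelocity longTimeAvgSup u ^ 2 + δ) :=
      mul_le_mul_of_nonneg_left (Real.sqrt_le_sqrt het.le) (mul_nonneg (abs_nonneg ν) hKL)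
    linarith [hstep t ht0]
  have hcont : Continuous fun δ : ℝ => δ + C * (rmsVelocity longTimeAvgSup u ^ 2 + δ) +
      |ν| * KL * Real.sqrt (rmsVelocity longTimeAvgSup u ^ 2 + δ) :=
    (continuous_id.add (continuous_const.mul (continuous_const.add continuous_id))).add
      (continuous_const.mul ((continuous_const.add continuous_id).sqrt))
  have h0 : (fun δ : ℝ => δ + C * (rmsVelocity longTimeAvgSup u ^ 2 + δ) +
      |ν| * KL * Real.sqrt (rmsVelocity longTimeAvgSup u ^ 2 + δ)) 0 =
      C * rmsVelocity longTimeAvgSup u ^ 2 + ν * KL * rmsVelocity longTimeAvgSup u := by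
    simp [Real.sqrt_sq hU0, abs_of_pos hν]
  rw [← h0]
  have hlim : Tendsto (fun δ : ℝ => δ + C * (rmsVelocity longTimeAvgSup u ^ 2 + δ) +
      |ν| * KL * Real.sqrt (rmsVelocity longTimeAvgSup u ^ 2 + δ)) (𝓝[>] 0)
      (𝓝 ((fun δ : ℝ => δ + C * (rmsVelocity longTimeAvgSup u ^ 2 + δ) +
        |ν| * KL * Real.sqrt (rmsVelocity longTimeAvgSup u ^ 2 + δ)) 0)) :=
    (hcont.tendsto 0).mono_left nhdsWithin_le_nhds
  exact ge_of_tendsto hlim (by filter_upwards [self_mem_nhdsWithin] with δ hδ using key δ hδ)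

end DoeringFoias

/-! ### Discharge of `DoeringFoias2002_amplitude_le` -/

/-- **Discharge of `DoeringFoias2002_amplitude_le`** (Cheskidov–Doering–Petrov 2007, §III
eqs. (18)–(19); Doering–Foias 2002, §3): for every forcing shape `Φ` on `T³`, with
`a = ‖∑ᵢ‖∂ᵢΦ‖‖_∞ + 1`, `b = ‖ΔΦ‖_∞ + 1` (constants depending on `Φ` only), every global
Leray–Hopf solution of the Navier–Stokes equations with viscosity `ν > 0` forced by `F Φ(n • ·)`,
`0 < n`, obeys `|F| ≤ a U²/ℓ + b ν U/ℓ²`, `ℓ = 1/n`, `U = ⟨‖u‖₂²⟩^{1/2}` (`limsup` average,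
no positivity hypothesis on `U`): `DoeringFoias.abs_amplitude_le_of_isGlobalLerayHopf` with the
dilation bounds `∑ᵢ‖∂ᵢ(Φ(n • ·))‖ ≤ n‖∑ᵢ‖∂ᵢΦ‖‖_∞` and `‖Δ(Φ(n • ·))‖ ≤ n²‖ΔΦ‖_∞` (the factors
`ℓ⁻¹`, `ℓ⁻²` of `‖∇̃ψ‖_∞ U²/ℓ`, `‖ψ‖_{H²} νU/ℓ²` in eq. (19)). [cite: CheskidovDoeringPetrov2006, §III eqs. (18)–(19)] -/
theorem DoeringFoias2002_amplitude_le_holds : DoeringFoias2002_amplitude_le := by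
  intro Φ
  obtain ⟨D, hD, hDb⟩ := exists_sum_norm_partialDeriv_comp_nsmul_le Φ
  obtain ⟨M, hM, hMb⟩ := exists_norm_laplacian_force_le Φ
  refine ⟨D + 1, M + 1, by linarith, by linarith, fun ν hν n hn F u₀ u hu => ?_⟩
  set U := rmsVelocity longTimeAvgSup u with hUdef
  have hU0 : 0 ≤ U := Real.sqrt_nonneg _
  have hn' : (0 : ℝ) < n := by exact_mod_cast hn
  -- the multiplier bounds for `Ψ = Φ(n • ·) = Φ.force n 1`
  have hCΨ : ∀ x, ∑ i, ‖Torus.partialDeriv i (Φ.force n 1) x‖ ≤ (n : ℝ) * D := fun x => by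
    rw [force_one_eq]; exact hDb n x
  have hL : ∀ x, ‖Torus.laplacian (Φ.force n 1) x‖ ≤ (n : ℝ) ^ 2 * M := fun x => by
    have h := hMb n 1 x
    rwa [abs_one, one_mul] at h
  have h := DoeringFoias.abs_amplitude_le_of_isGlobalLerayHopf hν hn hu (by positivity)
    (by positivity) hCΨ hL
  -- rewrite in the `ℓ = 1/n` form
  have e1 : (D + 1) * U ^ 2 / (n : ℝ)⁻¹ = (n : ℝ) * (D + 1) * U ^ 2 := by field_simp
  have e2 : (M + 1) * ν * U / (n : ℝ)⁻¹ ^ 2 = ν * ((n : ℝ) ^ 2 * (M + 1)) * U := by field_simp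
  rw [e1, e2]
  have h1 : (n : ℝ) * D * U ^ 2 ≤ (n : ℝ) * (D + 1) * U ^ 2 := by
    have : 0 ≤ (n : ℝ) * U ^ 2 := by positivity
    nlinarith
  have h2 : ν * ((n : ℝ) ^ 2 * M) * U ≤ ν * ((n : ℝ) ^ 2 * (M + 1)) * U := by
    have : 0 ≤ ν * (n : ℝ) ^ 2 * U := by positivity
    nlinarith
  linarith

end Literature.Analysis.FluidPDE

end
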